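import Mathlib
import HarnessLib
import Summits.HubbardSuperconductivity.HubbardSuperconductivity.Theorems.KLProgrammeKLRegimeTwoVolumeLipProfilesOfTower
import Summits.HubbardSuperconductivity.HubbardSuperconductivity.Theorems.KLProgrammeKLRegimeEngineTowerBlockIncrWtKitCarrier

/-!
# Route `KLProgramme` — crux K3 ENGINE (stmt-HubbardSuperconductivity-20437), stub (e) proof-input «(e)-D-ROWS», G-3 AT A FREE WEIGHT RATE: THE WEIGHTED PROFILES
# `NV`, `ND` OF THE FREE-RATE DEEP DOOR FROM E1's RATE-DECOUPLED MEASURED ARRAYS `klTowerMeasWtAt … j_w` AT BOTH VOLUMES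
# (seat hubbard-kl-k3c4-p1 g25; `--supports` 20437; DROWS-SCOPE-g25 §13 item 1; rate-`j_w` twin of `…TwoVolumeLipProfilesOfTower` (p712842))

The free-rate door `…LipBlockStepDeepRate.lipBlockStep_deep_rate_le` (and the `hstep` chain over it, `…LipBornDiffHstepRate`) reads the glued coarse input and the
input difference of block `k` in the glued weight `klGluedWt L b M β j_w` at the run's rate `j_w`.  Exactly as at rate `dk−1` (p712842), both profiles are
ONE-VOLUME data — now E1's RATE-DECOUPLED measured arrays `klTowerMeasWtAt V M β U μ K d k j_w m` (…EngineTowerModelDefsRate), the arrays E1's weighted tower law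
`…EngineTowerWtLawBaseTokX.klTowerBornWtAt_le_law_of_inputs_base_tokX` exports (third conjunct) at the read-out rate of the run:

* `sum_wt_norm_kernel_klLipInput_eq_at` — the `klScaleWt_{j_w}`-weighted pinned sum of `klLipInput V … d k` IS `ε · klWtPinnedSumAt V … (dk−1) j_w m 𝒱_{dk}`;
  `sum_wt_norm_kernel_klLipInput_le_at` — hence `≤ ε · klTowerMeasWtAt V … d k j_w m`;
* `glue_wt_profile_le_towerMeasWtAt` — `hNV` with `NV m := ε·klTowerMeasWtAt L M β U μ K d k j_w m`;
* `fine_gluedWt_profile_le_towerMeasWtAt` — the fine input in the glued weight `≤ ε·klTowerMeasWtAt (bL) … d k j_w m`;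
* **`inputDiff_wt_profile_le_towerMeasWtAt`** — `hND` with `ND m := ε·(klTowerMeasWtAt (bL) … d k j_w m + klTowerMeasWtAt L … d k j_w m)`.

Compositions of landed theorems; nothing asserts the (D) rows, stub (e), VL, K3 or superconductivity.
References: BGM 2006 §2.8 (2.76)–(2.83), §3 [cite: BenfattoGiulianiMastropietro2006].
-/

noncomputable section

namespace Summit.HubbardSuperconductivity.HubbardSuperconductivity.Theorems.TwoVolumeLip

set_option linter.dupNamespace false -- summit = problem name (single-conjunct summit), D-0017

open Finset Literature.MathematicalPhysics.QuantumLattice GrassmannAlgebra Literature.Probability.LatticeModels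
  Literature.Probability.LatticeModels.BattleFederbush
open Literature.MathematicalPhysics.QuantumLattice.FermiRG
open Summit.HubbardSuperconductivity.HubbardSuperconductivity.Theorems.KLRegimeSplit
open Summit.HubbardSuperconductivity.HubbardSuperconductivity.Theorems.KLProgrammeLegKernels
open Summit.HubbardSuperconductivity.HubbardSuperconductivity.Theorems.DispersionFlow
open Summit.HubbardSuperconductivity.HubbardSuperconductivity.Theorems.EngineV8
open Summit.HubbardSuperconductivity.HubbardSuperconductivity.Theorems.TwoVolumeSource
open Summit.HubbardSuperconductivity.HubbardSuperconductivity.Theorems.TwoVolumeDefect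

section OneVolume

variable {V M : ℕ} [NeZero V]

/-- **The rate-`j_w` `klScaleWt`-weighted pinned sum of `klLipInput` IS `ε ×` E1's rate-`j_w` measured weighted pinned sum of the input of block `k`** (`0 ≤ β`). -/
theorem sum_wt_norm_kernel_klLipInput_eq_at {β : ℝ} (hβ : 0 ≤ β) (U μ : ℝ) (K : TrigPolyC4v) (d k jw : ℕ) {m : ℕ} (q : Fin m)
    (w : SpaceTimeIdx V M × SectorLeg (sectorCount (d * k - 1))) :
    ∑ X ∈ univ.filter (fun X : Fin m → SpaceTimeIdx V M × SectorLeg (sectorCount (d * k - 1)) => X q = w),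
        klLabelWt (klScaleWt V M β jw) (univ.image X) * ‖kernel ℂ (klLipInput V M β U μ K d k) m X‖ =
      imagTimeWeight β M * klWtPinnedSumAt V M β μ K (d * k - 1) jw m (klTowerInput V M β U μ K d k) q w := by
  obtain ⟨n, rfl⟩ : ∃ n, m = n + 1 := ⟨m - 1, by have := q.pos; omega⟩
  unfold klWtPinnedSumAt
  rw [Nat.add_sub_cancel, ← mul_assoc, ← pow_succ', mul_sum]
  refine sum_congr rfl fun X _ => ?_
  rw [norm_kernel_klLipInput_eq hβ, klLabelWt_apply]
  ring

/-- Hence E1's rate-`j_w` size bounds the weighted pinned sums: `… ≤ ε · klTowerMeasWtAt … d k j_w m`. -/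
theorem sum_wt_norm_kernel_klLipInput_le_at {β : ℝ} (hβ : 0 ≤ β) (U μ : ℝ) (K : TrigPolyC4v) (d k jw : ℕ) {m : ℕ} (q : Fin m)
    (w : SpaceTimeIdx V M × SectorLeg (sectorCount (d * k - 1))) :
    ∑ X ∈ univ.filter (fun X : Fin m → SpaceTimeIdx V M × SectorLeg (sectorCount (d * k - 1)) => X q = w),
        klLabelWt (klScaleWt V M β jw) (univ.image X) * ‖kernel ℂ (klLipInput V M β U μ K d k) m X‖ ≤
      imagTimeWeight β M * klTowerMeasWtAt V M β U μ K d k jw m := by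
  rw [sum_wt_norm_kernel_klLipInput_eq_at hβ]
  exact mul_le_mul_of_nonneg_left (klWtPinnedSumAt_le_klTowerMeasWtAt β U μ K d k jw m q w) (imagTimeWeight_nonneg hβ M)

end OneVolume

variable {L b M : ℕ} [NeZero L] [NeZero (b * L)]

/-- **`hNV` from the coarse tower at rate `j_w`**: in the glued weight at rate `j_w` the pinned weighted profile of the glued coarse input of block `k` is at most
`ε · klTowerMeasWtAt L … d k j_w m` (`0 ≤ β`). -/
theorem glue_wt_profile_le_towerMeasWtAt {β : ℝ} (hβ : 0 ≤ β) (U μ : ℝ) (K : TrigPolyC4v) (d k jw : ℕ) {m : ℕ} (j : Fin m)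
    (x : SpaceTimeIdx (b * L) M × SectorLeg (sectorCount (d * k - 1))) :
    ∑ Y ∈ univ.filter (fun Y : Fin m → SpaceTimeIdx (b * L) M × SectorLeg (sectorCount (d * k - 1)) => Y j = x),
        ‖kernel ℂ (klGlue L b M (sectorCount (d * k - 1)) (klLipInput L M β U μ K d k)) m Y‖ *
          klGluedWt L b M β jw (sectorCount (d * k - 1)) (univ.image Y) ≤
      imagTimeWeight β M * klTowerMeasWtAt L M β U μ K d k jw m := by
  rw [sum_pinned_wt_norm_kernel_klGlue_eq]
  refine le_of_eq_of_le (sum_congr rfl fun Y _ => mul_comm _ _) ?_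
  exact sum_wt_norm_kernel_klLipInput_le_at hβ U μ K d k jw j _

/-- **The fine input in the glued weight at rate `j_w`**: `≤ ε · klTowerMeasWtAt (bL) … d k j_w m` (the glued weight is at most the fine weight). -/
theorem fine_gluedWt_profile_le_towerMeasWtAt {β : ℝ} (hβ : 0 ≤ β) (U μ : ℝ) (K : TrigPolyC4v) (d k jw : ℕ) {m : ℕ} (j : Fin m)
    (x : SpaceTimeIdx (b * L) M × SectorLeg (sectorCount (d * k - 1))) :
    ∑ Y ∈ univ.filter (fun Y : Fin m → SpaceTimeIdx (b * L) M × SectorLeg (sectorCount (d * k - 1)) => Y j = x),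
        ‖kernel ℂ (klLipInput (b * L) M β U μ K d k) m Y‖ * klGluedWt L b M β jw (sectorCount (d * k - 1)) (univ.image Y) ≤
      imagTimeWeight β M * klTowerMeasWtAt (b * L) M β U μ K d k jw m := by
  refine le_trans (sum_le_sum fun Y _ => mul_le_mul_of_nonneg_left (klGluedWt_le_klLabelWt_fine β jw (univ.image Y)) (norm_nonneg _)) ?_
  refine le_of_eq_of_le (sum_congr rfl fun Y _ => mul_comm _ _) ?_
  exact sum_wt_norm_kernel_klLipInput_le_at hβ U μ K d k jw j x

/-- **`hND` from the two towers at rate `j_w`**: in the glued weight at rate `j_w` the pinned weighted profile of the input difference of block `k` is at most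
`ε · (klTowerMeasWtAt (bL) … d k j_w m + klTowerMeasWtAt L … d k j_w m)` (`0 ≤ β`). -/
theorem inputDiff_wt_profile_le_towerMeasWtAt [NeZero M] {β : ℝ} (hβ : 0 ≤ β) (U μ : ℝ) (K : TrigPolyC4v) (d k jw : ℕ) {m : ℕ} (j : Fin m)
    (x : SpaceTimeIdx (b * L) M × SectorLeg (sectorCount (d * k - 1))) :
    ∑ Y ∈ univ.filter (fun Y : Fin m → SpaceTimeIdx (b * L) M × SectorLeg (sectorCount (d * k - 1)) => Y j = x),
        ‖kernel ℂ (klLipInputDiff L b M β U μ K d k) m Y‖ * klGluedWt L b M β jw (sectorCount (d * k - 1)) (univ.image Y) ≤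
      imagTimeWeight β M * (klTowerMeasWtAt (b * L) M β U μ K d k jw m + klTowerMeasWtAt L M β U μ K d k jw m) := by
  rw [klLipInputDiff_def, mul_add]
  exact sum_pinned_wt_norm_kernel_sub_le _ _ j x _ (fun S => (isTreeWeight_klGluedWt (L := L) (b := b) (M := M) hβ jw (sectorCount (d * k - 1))).nonneg S)
    (fine_gluedWt_profile_le_towerMeasWtAt hβ U μ K d k jw j x) (glue_wt_profile_le_towerMeasWtAt hβ U μ K d k jw j x)

end Summit.HubbardSuperconductivity.HubbardSuperconductivity.Theorems.TwoVolumeLip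

end
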